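import Summits.QuantumAdvantage.AdviceFreeQNC0.DualDistanceCount
import Summits.QuantumAdvantage.AdviceFreeQNC0.Elimination
import HarnessLib

/-!
# Cell qa-qnc0 (rung F-Q1, crux of record `TensorMultOneAt` = MULT₁): the fence "LP NEVER PAYS" —
# odd dual words of the degree-`t` even-triple code have weight `≥ 3·2^t`

Planner qa-qnc0-p1 gen 13 (`HOME/qa-qnc0-p1/ROUND-12.md` §2.7(a), prose proof; qn-lit LIT-MEMO-19
FENCE L24-A).  The single-block code at block degree `t` is `C_m^{(t)} = {u ↦ T_{|u| mod 3}(u) :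
(T₀,T₁,T₂)` even triple of `𝔽₂`-degree `≤ t` functions`}`.  A word `A ⊆ {0,1}^m` is an ODD DUAL WORD
if `|A|` is odd and `A` annihilates `C_m^{(t)}` (`OddDualWord`).  The covering LP behind every
norm-agnostic / fractional-packing induction on the tensor tower has value `≤ 2^m/d_t`, `d_t` the
minimum weight of an odd dual word; the payoff threshold is `2^m/2^{t+1}`.  PROVED here:

* `OddDualWords.sum_filter_ne_eq_zero`: each residue-class complement `A ∖ A_r` annihilates
  `lowDeg t` (test the even triple `(0, g, g)` rotated);
* `OddDualWords.filter_ne_nonempty`: and is nonempty (else `A` sits in one class and `g = 1` makes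
  `|A|` even);
* **`oddDualWord_card_ge : OddDualWord t A → 3 * 2 ^ t ≤ A.card`** — by the tree's dual-distance
  count (`two_pow_succ_le_card_of_sum_lowDeg_eq_zero`: a nonempty annihilator of `lowDeg t` has
  `≥ 2^{t+1}` points) applied to the three complements, `2|A| = Σ_r |A ∖ A_r| ≥ 3·2^{t+1}`.

Hence `d_t ≥ 3·2^t > 2^{t+1}·(3/2)`: the LP misses the payoff threshold by at least the factor `3/2`
per block at EVERY block degree (the planner's fence F12.3(a) in the tree's model).
WHAT THIS IS NOT: no statement about the LP itself (fractional covers are not formalised); nothing on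
MULT₁ (OPEN) or α; separation NOT moved.
-/

noncomputable section

namespace Summit.QuantumAdvantage.AdviceFreeQNC0

open Finset
open Literature.Computability.MetaComplexity Literature.Computability.MetaComplexity.Smolensky

variable {m : ℕ}

/-- `A ⊆ {0,1}^m` is an ODD DUAL WORD of the degree-`t` even-triple code: `|A|` is odd and
`Σ_{u ∈ A} P_{|u| mod 3}(u) = 0` for every even triple `P₀ + P₁ + P₂ = 0` of polynomials of
`𝔽₂`-degree `≤ t`.  (The cell's vocabulary: planner qa-qnc0-p1 ROUND-12 §2.7(a).) -/
def OddDualWord (t : ℕ) (A : Finset (Fin m → Bool)) : Prop :=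
  A.card % 2 = 1 ∧
    ∀ P : ℕ → CubeFn (ZMod 2) m, (∀ r, P r ∈ lowDeg (ZMod 2) m t) →
      (∀ u, P 0 u + P 1 u + P 2 u = 0) → ∑ u ∈ A, P (wt u % 3) u = 0

namespace OddDualWords

/-- The even triple `(0, g, g)` placed with the `0` at residue `r`. -/
def testTriple (r : ℕ) (g : CubeFn (ZMod 2) m) : ℕ → CubeFn (ZMod 2) m :=
  fun s => if s = r then 0 else g

/-- Each residue-class complement of an odd dual word annihilates `lowDeg t`. -/
theorem sum_filter_ne_eq_zero {t : ℕ} {A : Finset (Fin m → Bool)} (hA : OddDualWord t A)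
    {r : ℕ} (hr : r < 3) (g : CubeFn (ZMod 2) m) (hg : g ∈ lowDeg (ZMod 2) m t) :
    ∑ u ∈ A.filter (fun u => wt u % 3 ≠ r), g u = 0 := by
  have h := hA.2 (testTriple r g) (fun s => by
      unfold testTriple; split_ifs
      · exact Submodule.zero_mem _
      · exact hg)
    (fun u => by
      unfold testTriple
      have h2 : g u + g u = 0 := by
        rw [← two_mul]
        exact mul_eq_zero_of_left (by decide) _
      interval_cases r <;> simp [h2])
  rw [Finset.sum_filter]
  have hterm : ∀ u ∈ A, (if wt u % 3 ≠ r then g u else 0) = testTriple r g (wt u % 3) u := by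
    intro u _
    unfold testTriple
    rw [ite_apply, Pi.zero_apply]
    by_cases hu : wt u % 3 = r
    · rw [if_neg (not_not.2 hu), if_pos hu]
    · rw [if_pos hu, if_neg hu]
  rw [Finset.sum_congr rfl hterm]
  exact h

/-- Each residue-class complement of an odd dual word is nonempty. -/
theorem filter_ne_nonempty {t : ℕ} {A : Finset (Fin m → Bool)} (hA : OddDualWord t A)
    {r : ℕ} (hr : r < 3) : (A.filter (fun u => wt u % 3 ≠ r)).Nonempty := by
  rw [Finset.nonempty_iff_ne_empty]
  intro hempty
  -- then `A` sits inside class `r`; the complement of another class is all of `A`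
  obtain ⟨r', hr', hrr'⟩ : ∃ r', r' < 3 ∧ r' ≠ r := by
    rcases Nat.eq_zero_or_pos r with h | h
    · exact ⟨1, by norm_num, by omega⟩
    · exact ⟨0, by norm_num, by omega⟩
  have hall : A.filter (fun u => wt u % 3 ≠ r') = A := by
    refine Finset.filter_true_of_mem fun u hu => ?_
    have : ¬ (wt u % 3 ≠ r) := by
      intro hne
      have : u ∈ A.filter (fun u => wt u % 3 ≠ r) := Finset.mem_filter.2 ⟨hu, hne⟩
      rw [hempty] at this
      exact Finset.notMem_empty u this
    omega
  have h1 := sum_filter_ne_eq_zero hA hr' 1 (by rw [← mono_empty]; exact mono_mem_lowDeg (by simp))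
  rw [hall] at h1
  simp only [Pi.one_apply, sum_const, nsmul_eq_mul, mul_one] at h1
  have hev := (ZMod.natCast_eq_zero_iff_even).1 h1
  rw [Nat.even_iff] at hev
  have hodd := hA.1
  omega

/-- `Σ_{r<3} |A ∖ A_r| = 2|A|`. -/
theorem sum_card_filter_ne (A : Finset (Fin m → Bool)) :
    (A.filter fun u => wt u % 3 ≠ 0).card + (A.filter fun u => wt u % 3 ≠ 1).card +
      (A.filter fun u => wt u % 3 ≠ 2).card = 2 * A.card := by
  simp only [ne_eq]
  have h0 := Finset.card_filter_add_card_filter_not (s := A) (fun u => wt u % 3 = 0)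
  have h1 := Finset.card_filter_add_card_filter_not (s := A) (fun u => wt u % 3 = 1)
  have h2 := Finset.card_filter_add_card_filter_not (s := A) (fun u => wt u % 3 = 2)
  -- the three classes partition `A`
  have hpart : (A.filter fun u => wt u % 3 = 0).card + (A.filter fun u => wt u % 3 = 1).card +
      (A.filter fun u => wt u % 3 = 2).card = A.card := by
    have h := (Finset.card_eq_sum_card_fiberwise (s := A) (t := range 3) (f := fun u => wt u % 3)
      (fun u _ => by
        simp only [Finset.coe_range, Set.mem_Iio]
        exact Nat.mod_lt _ (by norm_num))).symm
    simp only [Finset.sum_range_succ, Finset.sum_range_zero, zero_add] at h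
    exact h
  omega

end OddDualWords

open OddDualWords

/-- **Odd dual words of the degree-`t` even-triple code have weight `≥ 3·2^t`** (planner qa-qnc0-p1
ROUND-12 §2.7(a); qn-lit LIT-MEMO-19 L24-A): each of the three residue-class complements of `A` is a
nonempty annihilator of `lowDeg t`, hence has `≥ 2^{t+1}` points, and they cover `A` twice. -/
theorem oddDualWord_card_ge {t : ℕ} {A : Finset (Fin m → Bool)} (hA : OddDualWord t A) :
    3 * 2 ^ t ≤ A.card := by
  have h0 := two_pow_succ_le_card_of_sum_lowDeg_eq_zero t _ (filter_ne_nonempty hA (r := 0) (by norm_num))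
    (fun g hg => sum_filter_ne_eq_zero hA (by norm_num) g hg)
  have h1 := two_pow_succ_le_card_of_sum_lowDeg_eq_zero t _ (filter_ne_nonempty hA (r := 1) (by norm_num))
    (fun g hg => sum_filter_ne_eq_zero hA (by norm_num) g hg)
  have h2 := two_pow_succ_le_card_of_sum_lowDeg_eq_zero t _ (filter_ne_nonempty hA (r := 2) (by norm_num))
    (fun g hg => sum_filter_ne_eq_zero hA (by norm_num) g hg)
  have hsum := sum_card_filter_ne A
  have : 2 ^ (t + 1) = 2 * 2 ^ t := by ring
  omega

/-- The transversals show the bound is attained at `t = 0` up to the class structure: conversely every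
odd dual word has at least `3` points (`t = 0` instance, for the record). -/
theorem three_le_card_of_oddDualWord {A : Finset (Fin m → Bool)} (hA : OddDualWord 0 A) : 3 ≤ A.card := by
  simpa using oddDualWord_card_ge hA

end Summit.QuantumAdvantage.AdviceFreeQNC0
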